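import Literature.RingTheory.Ideal.IdealsOfFiniteNorm
import Literature.Algebra.EuclideanDomain.SmallestAlgorithmFiniteValued
import Literature.Algebra.EuclideanDomain.NormalisedEuclideanAlgorithm
import HarnessLib

/-!
# Samuel's Remark (F): the fibres `φ⁻¹({n})` of an algorithm are finite when `A*` is finite (Samuel 1971, §3)

Topic `Literature/Algebra/EuclideanDomain`, namespace `Literature.Algebra.EuclideanDomain`.  THEOREMS ONLY (no `def`, no
instance, no named fact), all proved, in the vocabulary of `TransfiniteSmallestAlgorithm.lean` (`samuelSet R α = A_α`,
Samuel's transfinite construction; `samuelRank = θ`, the smallest algorithm), of `NormalisedEuclideanAlgorithm.lean`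
(Samuel's Definition 1: an *algorithm* is a map `φ : A → W`, `W` well ordered, with (E) «for `a, b ∈ A`, `b ≠ 0`, there
are `q, r` with `a = bq + r` and `φ(r) < φ(b)`», carried as the hypothesis `hφ`; Prop. 3 `Algorithm.isPrincipalIdealRing`),
and of `Literature/RingTheory/Ideal/IdealsOfFiniteNorm.lean` (Prop. 13).  Resolves the `TODO(general form)` of
`TransfiniteSmallestAlgorithm.lean` («Samuel's remark (F) (finiteness of the finite stages when `A*` is finite, via
Prop. 13) … [is] not formalised»).

## Source (read at the page)

P. Samuel, *About Euclidean rings*, J. Algebra **19** (1971) 282–301 [Samuel1971] (materialised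
`paper:doi-10-1016-0021-8693-71-90110-4`), §3 Remark (2) (pp. 286–287), VERBATIM: «The use of transfinite valued
algorithms, as in the proof of Prop. 6, is unavoidable in the case `A = ℤ × ℤ`.  In fact, we more generally notice:
(F) *If `A` is Euclidean for `φ`, if `A*` is finite and if `n` is an ordinary integer, then `A_n = φ⁻¹({n})` is finite.*
Proof.  By induction on `n`, `A_n′ = A₀ ∪ ⋯ ∪ A_{n−1}` is finite; if `φ(b) = n`, `A_n′ → A/Ab` is surjective.  Using
Prop. 13 of Section 5, we see that the ideal `Ab` can take only a finite number of values.  Hence the element `b` also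
since `A*` is finite.  This being so, suppose that `φ : ℤ × ℤ → N` is an algorithm, and set `φ((1, 0)) = n`.  Then, as above
in (F), `A_n′ = A₀ ∪ ⋯ ∪ A_{n−1}` is finite and `A_n′ → (ℤ × ℤ)/((1, 0))` is surjective.  This is impossible since this last
ring, isomorphic to `ℤ`, is infinite.»  Prop. 13 (p. 292): «In a noetherian ring `A`, the number of ideals having a given
finite norm is finite» (tree: `Literature.RingTheory.Ideal.finite_setOf_natCard_quotient_eq`, `…_le`).  Prop. 3 (p. 283):
«Every ideal `𝔟` of the Euclidean ring `A` is principal», so a Euclidean ring is noetherian and Prop. 13 applies.  Prop. 15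
(p. 294): «In a Euclidean domain `A` with finite residue fields, the smallest algorithm `θ` is finite valued» (tree:
`SmallestAlgorithmFiniteValued.lean`, stated there for rings with `A/Ab` finite, `b ≠ 0`).

## What is formalised

* §1 «Hence the element `b` also since `A*` is finite» — the step from ideals to elements, which Samuel leaves to the
  reader: the generators of the principal ideal `Ab` are the unit multiples `ub` as soon as `b` lies in only finitely many
  maximal ideals, in particular when `A/Ab` is finite (`exists_unit_mul_eq_of_span_singleton_eq`, `…_of_finite`,
  `finite_setOf_span_singleton_eq`).  In a domain this is Mathlib's `Ideal.span_singleton_eq_span_singleton`; for rings with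
  zero-divisors such as `ℤ × ℤ` (where (F) is applied) we supply the argument: `b′ = cb`, `b = db′`, `e = 1 − cd` kills `b`,
  and `c` is corrected along `e` to `u = c + ey ≡ 1` modulo the finitely many maximal ideals containing `b` but not `e`;
  such a `u` lies in no maximal ideal and `ub = b′`.
* §2 the inductive step of (F) as one statement: in a noetherian ring with finitely many units, for a FINITE set `S` the
  elements `b` such that `S → A/Ab` is surjective form a finite set (`finite_setOf_forall_exists_dvd_sub`: their ideals
  `Ab` have finite norm `≤ card S`, Prop. 13 leaves finitely many ideals, §1 finitely many generators of each).
* §3 **(F) for the transfinite construction**: in a noetherian ring with `A*` finite every finite stage `A_n` is finite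
  (`finite_samuelSet_natCast`), hence so is each fibre `θ⁻¹({n})`, `n ≥ 1`, of the smallest algorithm
  (`finite_setOf_samuelRank_eq_natCast`); for a ring exhausted by its construction (Samuel's «Euclidean») noetherianity
  is automatic (`finite_samuelSet_natCast_of_forall_exists_mem`, `finite_setOf_samuelRank_eq_natCast_of_forall_exists_mem`).
* §4 **(F) as printed, for an arbitrary algorithm** `φ : A → W` (`W` any well-ordered type) on a ring with `A*` finite:
  for every value `w` preceded by finitely many values («`n` an ordinary integer») the sets `{φ < w}`, `φ⁻¹({w})`,
  `{φ ≤ w}` are finite (`Algorithm.finite_setOf_apply_lt` / `_eq` / `_le`), with the `ℕ`-valued and ordinal-valued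
  specialisations (`Algorithm.finite_setOf_apply_eq_nat`, `Algorithm.finite_setOf_apply_eq_natCast`, …).
* §5 the mechanism of the `ℤ × ℤ` example in general: with `A*` finite, `A/Ab` is finite for every `b ≠ 0` whose value is
  preceded by finitely many values (`Algorithm.finite_quotient_span_singleton`), so a ring with finitely many units and
  some `b ≠ 0` with `A/Ab` infinite carries no `ℕ`-valued algorithm, in Samuel's form (E) and in Motzkin's form
  (`Algorithm.not_exists_nat_of_infinite_quotient`, `not_exists_euclideanFunction_of_infinite_quotient`); together with
  Prop. 15: **a ring with finitely many units exhausted by its transfinite construction carries an ordinary `ℕ`-valued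
  algorithm iff all its residue rings `A/Ab`, `b ≠ 0`, are finite** (`exists_euclideanFunction_iff_finite_quotients`).
  The instance `ℤ × ℤ`, `b = (1, 0)` is the tree's `IntProd.not_exists_algorithm_nat` / `IntProd.finite_compl_motzkinSet`
  (`IntProdIntTransfiniteEuclidean.lean`, proved there by a direct box argument) and is not restated here.

## Mathlib / tree search

Mathlib: `Ideal.span_singleton_eq_span_singleton` (domains only), `exists_max_ideal_of_mem_nonunits`,
`Ideal.IsPrime.inf_le'`, `Ideal.mem_span_singleton_sup`, `Ideal.comap_map_of_surjective`, `PrincipalIdealRing.isNoetherianRing`,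
`Set.Finite.biUnion`, `Nat.card_le_card_of_surjective`, `Set.finite_Iio`, `Ordinal.lt_omega0`, `WellFoundedLT.induction`.  Tree
(`lean search 'span_singleton_eq_span_singleton'`): `BlowupStrictTransform.lean` has the non-zero-divisor case only
(`isUnit_of_span_singleton_eq_span_singleton_of_eq_mul`); `IdealsOfFiniteNorm.lean` (`finite_setOf_finite_quotient_natCard_le`);
`TransfiniteSmallestAlgorithm.lean` (`samuelSet_zero`, `samuelSet_add_one`, `mem_samuelSet_samuelRank`,
`exists_mem_samuelSet_of_samuelRank_ne_zero`, `samuelRank_eq_zero_iff`, `samuelRank_isAlgorithm`,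
`exists_euclideanFunction_iff_iUnion_samuelSet_natCast`); `UniversalSideDivisors.lean` (`isPrincipalIdealRing_of_euclideanFunction`);
`NormalisedEuclideanAlgorithm.lean` (`Algorithm.isPrincipalIdealRing`); `SmallestAlgorithmFiniteValued.lean`
(`exists_euclideanFunction_of_finite_quotients`).
-/

namespace Literature.Algebra.EuclideanDomain

universe u v

/-! ## §1 Generators of a principal ideal lying in finitely many maximal ideals -/

section Generators

variable {A : Type*} [CommRing A]

/-- The ideals containing `J` are finite in number when `A/J` is finite (they correspond injectively, under
`I ↦ I·(A/J)`, to ideals of the finite ring `A/J`); plumbing for §1. [folklore] -/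
private theorem finite_setOf_ideal_le (J : Ideal A) [Finite (A ⧸ J)] : {I : Ideal A | J ≤ I}.Finite := by
  haveI : Finite (Ideal (A ⧸ J)) :=
    Finite.of_injective (fun I : Ideal (A ⧸ J) ↦ (I : Set (A ⧸ J))) SetLike.coe_injective
  refine Set.Finite.of_finite_image (Set.toFinite _) (f := fun I : Ideal A ↦ I.map (Ideal.Quotient.mk J)) ?_
  intro I hI I' hI' h
  have key : ∀ K : Ideal A, J ≤ K → Ideal.comap (Ideal.Quotient.mk J) (K.map (Ideal.Quotient.mk J)) = K := by
    intro K hK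
    rw [Ideal.comap_map_of_surjective _ Ideal.Quotient.mk_surjective, ← RingHom.ker_eq_comap_bot,
      Ideal.mk_ker, sup_eq_left.2 hK]
  simp only at h
  rw [← key I hI, ← key I' hI', h]

/-- In particular the maximal ideals containing `b` are finite in number when `A/Ab` is finite; plumbing for §1.
[folklore] -/
private theorem finite_setOf_isMaximal_mem (b : A) [Finite (A ⧸ Ideal.span {b})] :
    {m : Ideal A | m.IsMaximal ∧ b ∈ m}.Finite :=
  (finite_setOf_ideal_le (Ideal.span {b})).subset fun _ hm ↦ (Ideal.span_singleton_le_iff_mem _).2 hm.2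

/-- **«Hence the element `b` also since `A*` is finite»** — from ideals to elements: if `Ab′ = Ab` and `b` lies in only
finitely many maximal ideals, then `b′ = ub` for a unit `u`.  (Write `b′ = cb`, `b = db′`, `e = 1 − cd`, so that `be = 0`;
choose `y` with `c + ey ≡ 1` modulo each of the finitely many maximal ideals containing `b` but not `e`; then `u = c + ey`
lies in no maximal ideal — one containing `e` would contain `c` and `1 = e + cd`, one not containing `e` contains `b` —
and `ub = cb = b′`.)  In a domain this is Mathlib's `Ideal.span_singleton_eq_span_singleton`; Samuel applies it to rings
with zero-divisors (`ℤ × ℤ`), where it is the statement proved here.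
[cite: Samuel1971, §3 Remark (F) (p. 287), the step «Hence the element `b` also since `A*` is finite»] -/
theorem exists_unit_mul_eq_of_span_singleton_eq {b b' : A} (hfin : {m : Ideal A | m.IsMaximal ∧ b ∈ m}.Finite)
    (h : Ideal.span {b'} = Ideal.span {b}) : ∃ u : Aˣ, (u : A) * b = b' := by
  have hb' : b' ∈ Ideal.span {b} := h ▸ Ideal.mem_span_singleton_self b'
  have hb : b ∈ Ideal.span {b'} := h.symm ▸ Ideal.mem_span_singleton_self b
  obtain ⟨c, hc⟩ := Ideal.mem_span_singleton'.1 hb'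
  obtain ⟨d, hd⟩ := Ideal.mem_span_singleton'.1 hb
  obtain ⟨e, he⟩ : ∃ e : A, e = 1 - c * d := ⟨_, rfl⟩
  have hbe : b * e = 0 := by
    rw [he]
    linear_combination (-d) * hc - hd
  have hcd : e + c * d = 1 := by rw [he]; ring
  -- the finitely many maximal ideals containing `b` but not `e`, and their intersection `N`
  have hM : {m : Ideal A | m.IsMaximal ∧ b ∈ m ∧ e ∉ m}.Finite := hfin.subset fun m hm ↦ ⟨hm.1, hm.2.1⟩
  set N : Ideal A := hM.toFinset.inf id with hN
  have hNle : ∀ m : Ideal A, m.IsMaximal → b ∈ m → e ∉ m → N ≤ m := fun m hm hbm hem ↦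
    Finset.inf_le (f := id) (hM.mem_toFinset.2 ⟨hm, hbm, hem⟩)
  -- `e` is invertible modulo `N`
  have htop : Ideal.span {e} ⊔ N = ⊤ := by
    by_contra hne
    obtain ⟨m₀, hm₀, hle⟩ := Ideal.exists_le_maximal _ hne
    have he₀ : e ∈ m₀ := hle (Ideal.mem_sup_left (Ideal.mem_span_singleton_self e))
    have hN₀ : N ≤ m₀ := le_sup_right.trans hle
    obtain ⟨m, hm, hmm₀⟩ := (Ideal.IsPrime.inf_le' hm₀.isPrime).1 hN₀
    rw [Set.Finite.mem_toFinset] at hm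
    obtain ⟨hm, -, hem⟩ := hm
    have hmm₀ : m ≤ m₀ := hmm₀
    exact hem ((hm.eq_of_le hm₀.ne_top hmm₀).symm ▸ he₀)
  have hmem : (1 - c) ∈ Ideal.span {e} ⊔ N := by rw [htop]; exact Submodule.mem_top
  obtain ⟨y, z, hz, hyz⟩ := Ideal.mem_span_singleton_sup.1 hmem
  -- `u = c + ye = 1 - z` is a unit
  have hu : IsUnit (c + y * e) := by
    by_contra hnu
    obtain ⟨m, hm, hum⟩ := exists_max_ideal_of_mem_nonunits (mem_nonunits_iff.2 hnu)
    by_cases hem : e ∈ m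
    · have hcm : c ∈ m := by
        have := m.sub_mem hum (m.mul_mem_left y hem)
        rwa [add_sub_cancel_right] at this
      refine hm.ne_top ((Ideal.eq_top_iff_one _).2 ?_)
      rw [← hcd]
      exact m.add_mem hem (m.mul_mem_right d hcm)
    · have hbm : b ∈ m :=
        (hm.isPrime.mem_or_mem (show b * e ∈ m by rw [hbe]; exact m.zero_mem)).resolve_right hem
      refine hm.ne_top ((Ideal.eq_top_iff_one _).2 ?_)
      have h1 : (1 : A) = (c + y * e) + z := by linear_combination -hyz
      rw [h1]
      exact m.add_mem hum (hNle m hm hbm hem hz)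
  refine ⟨hu.unit, ?_⟩
  rw [IsUnit.unit_spec]
  linear_combination hc + y * hbe

/-- The same with the hypothesis «`A/Ab` is finite» (Samuel's situation: `Ab` has finite norm).
[cite: Samuel1971, §3 Remark (F) (p. 287), the step «Hence the element `b` also since `A*` is finite»] -/
theorem exists_unit_mul_eq_of_span_singleton_eq_of_finite {b b' : A} [Finite (A ⧸ Ideal.span {b})]
    (h : Ideal.span {b'} = Ideal.span {b}) : ∃ u : Aˣ, (u : A) * b = b' :=
  exists_unit_mul_eq_of_span_singleton_eq (finite_setOf_isMaximal_mem b) h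

/-- With finitely many units («`A*` is finite»), a principal ideal `Ab` lying in finitely many maximal ideals has only
finitely many generators. [cite: Samuel1971, §3 Remark (F) (p. 287)] -/
theorem finite_setOf_span_singleton_eq [Finite Aˣ] {b : A} (hfin : {m : Ideal A | m.IsMaximal ∧ b ∈ m}.Finite) :
    {b' : A | Ideal.span {b'} = Ideal.span {b}}.Finite :=
  (Set.finite_range fun u : Aˣ ↦ (u : A) * b).subset fun _ hb' ↦
    exists_unit_mul_eq_of_span_singleton_eq hfin hb'

/-- With finitely many units, an ideal `Ab` of finite norm has only finitely many generators.
[cite: Samuel1971, §3 Remark (F) (p. 287)] -/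
theorem finite_setOf_span_singleton_eq_of_finite [Finite Aˣ] (b : A) [Finite (A ⧸ Ideal.span {b})] :
    {b' : A | Ideal.span {b'} = Ideal.span {b}}.Finite :=
  finite_setOf_span_singleton_eq (finite_setOf_isMaximal_mem b)

end Generators

/-! ## §2 The inductive step: finitely many `b` with `S → A/Ab` surjective, `S` finite -/

section Step

variable {A : Type*} [CommRing A]

/-- «`A_n′ → A/Ab` is surjective»: if every class mod `Ab` has a representative in a finite set `S`, then `A/Ab` is
finite, of cardinality at most `card S`. [cite: Samuel1971, §3 Remark (F) (p. 287)] -/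
theorem finite_quotient_of_forall_exists_dvd_sub {S : Set A} (hS : S.Finite) {b : A}
    (hb : ∀ a : A, ∃ r ∈ S, b ∣ a - r) :
    Finite (A ⧸ Ideal.span {b}) ∧ Nat.card (A ⧸ Ideal.span {b}) ≤ Nat.card S := by
  haveI : Finite S := hS.to_subtype
  have hsurj : Function.Surjective (fun r : S ↦ Ideal.Quotient.mk (Ideal.span {b}) (r : A)) := by
    intro x
    obtain ⟨a, rfl⟩ := Ideal.Quotient.mk_surjective x
    obtain ⟨r, hr, hdvd⟩ := hb a
    refine ⟨⟨r, hr⟩, ?_⟩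
    show Ideal.Quotient.mk (Ideal.span {b}) r = Ideal.Quotient.mk (Ideal.span {b}) a
    rw [Ideal.Quotient.eq, Ideal.mem_span_singleton]
    exact dvd_sub_comm.1 hdvd
  exact ⟨Finite.of_surjective _ hsurj, Nat.card_le_card_of_surjective _ hsurj⟩

/-- **The inductive step of (F)**: in a noetherian ring with finitely many units, for a finite set `S` the elements `b`
such that `S → A/Ab` is surjective form a finite set — «using Prop. 13 … the ideal `Ab` can take only a finite number
of values.  Hence the element `b` also since `A*` is finite». [cite: Samuel1971, §3 Remark (F) (p. 287)] -/
theorem finite_setOf_forall_exists_dvd_sub [IsNoetherianRing A] [Finite Aˣ] {S : Set A} (hS : S.Finite) :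
    {b : A | ∀ a : A, ∃ r ∈ S, b ∣ a - r}.Finite := by
  have hT := Literature.RingTheory.Ideal.finite_setOf_finite_quotient_natCard_le (A := A) (Nat.card S)
  refine ((hT.biUnion (t := fun I ↦ {b : A | (∀ a : A, ∃ r ∈ S, b ∣ a - r) ∧ Ideal.span {b} = I}))
    fun I _ ↦ ?_).subset fun b hb ↦ ?_
  · -- each fibre is empty or consists of generators of one ideal `Ab₀` of finite norm
    show {b : A | (∀ a : A, ∃ r ∈ S, b ∣ a - r) ∧ Ideal.span {b} = I}.Finite
    rcases Set.eq_empty_or_nonempty {b : A | (∀ a : A, ∃ r ∈ S, b ∣ a - r) ∧ Ideal.span {b} = I} with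
      h0 | ⟨b₀, hb₀, hb₀I⟩
    · rw [h0]
      exact Set.finite_empty
    · haveI := (finite_quotient_of_forall_exists_dvd_sub hS hb₀).1
      exact (finite_setOf_span_singleton_eq_of_finite b₀).subset fun b hb ↦ hb.2.trans hb₀I.symm
  · simp only [Set.mem_iUnion, Set.mem_setOf_eq, exists_prop]
    exact ⟨Ideal.span {b}, finite_quotient_of_forall_exists_dvd_sub hS hb, hb, rfl⟩

end Step

/-! ## §3 (F) for the transfinite construction and the smallest algorithm -/

section Stages

variable {R : Type u} [CommRing R]

/-- **(F) for the transfinite construction**: in a noetherian ring with finitely many units every finite stage `A_n` is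
finite («by induction on `n`», `A₀ = {0}` and the inductive step §2). [cite: Samuel1971, §3 Remark (F) (p. 287)] -/
theorem finite_samuelSet_natCast [IsNoetherianRing R] [Finite Rˣ] (n : ℕ) :
    (samuelSet R (n : Ordinal.{u})).Finite := by
  induction n with
  | zero =>
    rw [Nat.cast_zero, samuelSet_zero]
    exact Set.finite_singleton 0
  | succ n ih =>
    rw [Nat.cast_succ, samuelSet_add_one]
    exact ((Set.finite_singleton (0 : R)).union (finite_setOf_forall_exists_dvd_sub ih)).subset
      fun b hb ↦ hb.elim (fun h ↦ Or.inl h) fun h ↦ Or.inr h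

/-- Hence the fibres `θ⁻¹({n})`, `n ≥ 1` an ordinary integer, of the smallest algorithm are finite.  (For `n = 0` the
tree's `θ` takes the junk value `0` off `⋃_α A_α`, so `θ⁻¹({0})` is `{0}` only for rings exhausted by the construction —
next statement.) [cite: Samuel1971, §3 Remark (F) (p. 287)] -/
theorem finite_setOf_samuelRank_eq_natCast [IsNoetherianRing R] [Finite Rˣ] {n : ℕ} (hn : n ≠ 0) :
    {x : R | samuelRank x = n}.Finite := by
  refine (finite_samuelSet_natCast n).subset fun x hx ↦ ?_
  have hx : samuelRank x = n := hx
  have h0 : samuelRank x ≠ 0 := by rw [hx]; exact_mod_cast hn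
  rw [← hx]
  exact mem_samuelSet_samuelRank (exists_mem_samuelSet_of_samuelRank_ne_zero h0)

/-- For a ring exhausted by its transfinite construction (Samuel's «`A` is Euclidean») noetherianity is automatic
(Prop. 3: `θ` is an algorithm, so every ideal is principal), and every finite stage `A_n` is finite as soon as `A*` is.
[cite: Samuel1971, §3 Remark (F) (p. 287)] -/
theorem finite_samuelSet_natCast_of_forall_exists_mem [Finite Rˣ] (h : ∀ z : R, ∃ β : Ordinal.{u}, z ∈ samuelSet R β)
    (n : ℕ) : (samuelSet R (n : Ordinal.{u})).Finite := by
  haveI := Algorithm.isPrincipalIdealRing (samuelRank_isAlgorithm h)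
  exact finite_samuelSet_natCast n

/-- **(F) for the smallest algorithm `θ` of a Euclidean ring with `A*` finite**: `θ⁻¹({n})` is finite for every ordinary
integer `n`. [cite: Samuel1971, §3 Remark (F) (p. 287)] -/
theorem finite_setOf_samuelRank_eq_natCast_of_forall_exists_mem [Finite Rˣ]
    (h : ∀ z : R, ∃ β : Ordinal.{u}, z ∈ samuelSet R β) (n : ℕ) : {x : R | samuelRank x = n}.Finite := by
  haveI := Algorithm.isPrincipalIdealRing (samuelRank_isAlgorithm h)
  rcases eq_or_ne n 0 with rfl | hn
  · refine (Set.finite_singleton (0 : R)).subset fun x hx ↦ ?_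
    exact (samuelRank_eq_zero_iff (h x)).1 (by exact_mod_cast hx)
  · exact finite_setOf_samuelRank_eq_natCast hn

/-- A non-zero element of a finite stage `A_{n}` of a noetherian ring with finitely many units has a finite residue ring
`A/Ab` (its classes are represented in the finite set `A_{n-1}`). [cite: Samuel1971, §3 Remark (F) (p. 287)] -/
theorem finite_quotient_span_singleton_of_mem_samuelSet_natCast [IsNoetherianRing R] [Finite Rˣ] {b : R} (hb0 : b ≠ 0)
    {n : ℕ} (hb : b ∈ samuelSet R (n : Ordinal.{u})) : Finite (R ⧸ Ideal.span {b}) := by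
  induction n with
  | zero =>
    rw [Nat.cast_zero, samuelSet_zero] at hb
    exact absurd hb hb0
  | succ n _ =>
    rw [Nat.cast_succ, samuelSet_add_one] at hb
    exact (finite_quotient_of_forall_exists_dvd_sub (finite_samuelSet_natCast n) (hb.resolve_left hb0)).1

end Stages

/-! ## §4 (F) as printed: an arbitrary algorithm `φ : A → W` -/

namespace Algorithm

section General

variable {R : Type u} [CommRing R] {W : Type*} [LinearOrder W] [WellFoundedLT W] {φ : R → W}

omit [WellFoundedLT W] in
/-- «if `φ(b) = n`, `A_n′ → A/Ab` is surjective»: a fibre `φ⁻¹({w})` consists of `0` and of elements `b` all of whose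
classes mod `Ab` have a representative of value `< w`. [cite: Samuel1971, §3 Remark (F) (p. 287)] -/
theorem setOf_apply_eq_subset (hφ : ∀ a b : R, b ≠ 0 → ∃ q r : R, a = b * q + r ∧ φ r < φ b) (w : W) :
    {x : R | φ x = w} ⊆ insert 0 {b : R | ∀ a : R, ∃ r ∈ {x : R | φ x < w}, b ∣ a - r} := by
  intro b hb
  have hb : φ b = w := hb
  by_cases hb0 : b = 0
  · exact Or.inl hb0
  · refine Or.inr fun a ↦ ?_
    obtain ⟨q, r, hqr, hr⟩ := hφ a b hb0
    exact ⟨r, show φ r < w from hb ▸ hr, ⟨q, by rw [hqr]; ring⟩⟩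

variable [Finite Rˣ]

/-- **(F)**, the sets `A_w′ = {x | φ(x) < w}`: for an algorithm `φ : A → W` on a ring with finitely many units and a value
`w` preceded by only finitely many elements of `W` («an ordinary integer»), `{x | φ(x) < w}` is finite — by induction over
the well-ordered `W`, each fibre below `w` being finite by the inductive step §2 (the ring is noetherian by Prop. 3).
[cite: Samuel1971, §3 Remark (F) (p. 287)] -/
theorem finite_setOf_apply_lt (hφ : ∀ a b : R, b ≠ 0 → ∃ q r : R, a = b * q + r ∧ φ r < φ b) {w : W}
    (hw : (Set.Iio w).Finite) : {x : R | φ x < w}.Finite := by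
  haveI := isPrincipalIdealRing hφ
  induction w using WellFoundedLT.induction with
  | ind w ih =>
    have hU : {x : R | φ x < w} ⊆ ⋃ v ∈ Set.Iio w, {x : R | φ x = v} := fun x hx ↦
      Set.mem_biUnion (t := fun v ↦ {x : R | φ x = v}) hx rfl
    refine (hw.biUnion (t := fun v ↦ {x : R | φ x = v}) fun v hv ↦ ?_).subset hU
    have hv : v < w := hv
    have hfin : {x : R | φ x < v}.Finite := ih v hv (hw.subset fun u hu ↦ lt_trans hu hv)
    exact ((finite_setOf_forall_exists_dvd_sub hfin).insert 0).subset (setOf_apply_eq_subset hφ v)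

/-- **(F) as printed**: «If `A` is Euclidean for `φ`, if `A*` is finite and if `n` is an ordinary integer, then
`A_n = φ⁻¹({n})` is finite» — for any well-ordered value set `W` and any value `w` with finitely many predecessors.
[cite: Samuel1971, §3 Remark (F) (p. 287)] -/
theorem finite_setOf_apply_eq (hφ : ∀ a b : R, b ≠ 0 → ∃ q r : R, a = b * q + r ∧ φ r < φ b) {w : W}
    (hw : (Set.Iio w).Finite) : {x : R | φ x = w}.Finite := by
  haveI := isPrincipalIdealRing hφ
  exact ((finite_setOf_forall_exists_dvd_sub (finite_setOf_apply_lt hφ hw)).insert 0).subset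
    (setOf_apply_eq_subset hφ w)

/-- … and `A_w = {x | φ(x) ≤ w}` is finite. [cite: Samuel1971, §3 Remark (F) (p. 287)] -/
theorem finite_setOf_apply_le (hφ : ∀ a b : R, b ≠ 0 → ∃ q r : R, a = b * q + r ∧ φ r < φ b) {w : W}
    (hw : (Set.Iio w).Finite) : {x : R | φ x ≤ w}.Finite :=
  ((finite_setOf_apply_lt hφ hw).union (finite_setOf_apply_eq hφ hw)).subset fun _ hx ↦ lt_or_eq_of_le hx

/-- «`A_n′ → A/Ab` is surjective … impossible since this last ring … is infinite»: with `A*` finite, `A/Ab` is finite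
(of cardinality at most `card {x | φ x < φ b}`) for every `b ≠ 0` whose value has finitely many predecessors.
[cite: Samuel1971, §3 Remark (2) (p. 287)] -/
theorem finite_quotient_span_singleton (hφ : ∀ a b : R, b ≠ 0 → ∃ q r : R, a = b * q + r ∧ φ r < φ b) {b : R}
    (hb : b ≠ 0) (hw : (Set.Iio (φ b)).Finite) :
    Finite (R ⧸ Ideal.span {b}) ∧ Nat.card (R ⧸ Ideal.span {b}) ≤ Nat.card {x : R | φ x < φ b} := by
  refine finite_quotient_of_forall_exists_dvd_sub (finite_setOf_apply_lt hφ hw) fun a ↦ ?_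
  obtain ⟨q, r, hqr, hr⟩ := hφ a b hb
  exact ⟨r, hr, ⟨q, by rw [hqr]; ring⟩⟩

end General

section NatValued

variable {R : Type u} [CommRing R] [Finite Rˣ]

/-- (F) for an ordinary, `ℕ`-valued algorithm: every fibre `φ⁻¹({n})` is finite. [cite: Samuel1971, §3 Remark (F) (p. 287)] -/
theorem finite_setOf_apply_eq_nat {φ : R → ℕ} (hφ : ∀ a b : R, b ≠ 0 → ∃ q r : R, a = b * q + r ∧ φ r < φ b)
    (n : ℕ) : {x : R | φ x = n}.Finite :=
  finite_setOf_apply_eq hφ (Set.finite_Iio n)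

/-- (F) for an `ℕ`-valued algorithm: `{x | φ x < n}` is finite. [cite: Samuel1971, §3 Remark (F) (p. 287)] -/
theorem finite_setOf_apply_lt_nat {φ : R → ℕ} (hφ : ∀ a b : R, b ≠ 0 → ∃ q r : R, a = b * q + r ∧ φ r < φ b)
    (n : ℕ) : {x : R | φ x < n}.Finite :=
  finite_setOf_apply_lt hφ (Set.finite_Iio n)

/-- With `A*` finite, an `ℕ`-valued algorithm forces every residue ring `A/Ab`, `b ≠ 0`, to be finite.
[cite: Samuel1971, §3 Remark (2) (p. 287)] -/
theorem finite_quotient_span_singleton_nat {φ : R → ℕ}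
    (hφ : ∀ a b : R, b ≠ 0 → ∃ q r : R, a = b * q + r ∧ φ r < φ b) {b : R} (hb : b ≠ 0) :
    Finite (R ⧸ Ideal.span {b}) :=
  (finite_quotient_span_singleton hφ hb (Set.finite_Iio _)).1

/-- **Samuel's `ℤ × ℤ` argument in general**: a ring with finitely many units having an element `b ≠ 0` with `A/Ab`
infinite (for `ℤ × ℤ`: `b = (1, 0)`, `(ℤ × ℤ)/((1, 0)) ≅ ℤ`) carries no `ℕ`-valued algorithm (Definition 1 with `W = ℕ`).
The instance `ℤ × ℤ` is `IntProd.not_exists_algorithm_nat`. [cite: Samuel1971, §3 Remark (2) (p. 287)] -/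
theorem not_exists_nat_of_infinite_quotient {b : R} (hb : b ≠ 0) [Infinite (R ⧸ Ideal.span {b})] :
    ¬ ∃ φ : R → ℕ, ∀ a b : R, b ≠ 0 → ∃ q r : R, a = b * q + r ∧ φ r < φ b := by
  rintro ⟨φ, hφ⟩
  haveI := finite_quotient_span_singleton_nat hφ hb
  exact not_finite (R ⧸ Ideal.span {b})

end NatValued

section OrdinalValued

variable {R : Type u} [CommRing R] [Finite Rˣ]

/-- An ordinary integer has finitely many predecessors among the ordinals (plumbing). [folklore] -/
private theorem finite_Iio_natCast_ordinal (n : ℕ) : (Set.Iio (n : Ordinal.{v})).Finite := by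
  refine ((Set.finite_Iio n).image (Nat.cast : ℕ → Ordinal.{v})).subset fun o ho ↦ ?_
  have ho : o < n := ho
  obtain ⟨m, rfl⟩ := Ordinal.lt_omega0.1 (lt_trans ho (Ordinal.natCast_lt_omega0 n))
  exact ⟨m, show m < n by exact_mod_cast ho, rfl⟩

/-- (F) in Samuel's setting `φ : A → W`, `W` an ordinal, `n` «an ordinary integer»: `φ⁻¹({n})` is finite.
[cite: Samuel1971, §3 Remark (F) (p. 287)] -/
theorem finite_setOf_apply_eq_natCast {φ : R → Ordinal.{v}}
    (hφ : ∀ a b : R, b ≠ 0 → ∃ q r : R, a = b * q + r ∧ φ r < φ b) (n : ℕ) : {x : R | φ x = n}.Finite :=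
  finite_setOf_apply_eq hφ (finite_Iio_natCast_ordinal n)

/-- … and `A_n′ = {x | φ(x) < n}` is finite. [cite: Samuel1971, §3 Remark (F) (p. 287)] -/
theorem finite_setOf_apply_lt_natCast {φ : R → Ordinal.{v}}
    (hφ : ∀ a b : R, b ≠ 0 → ∃ q r : R, a = b * q + r ∧ φ r < φ b) (n : ℕ) : {x : R | φ x < n}.Finite :=
  finite_setOf_apply_lt hφ (finite_Iio_natCast_ordinal n)

end OrdinalValued

end Algorithm

/-! ## §5 Motzkin's form and the synthesis with Proposition 15 -/

section Synthesis

variable {R : Type u} [CommRing R] [Finite Rˣ]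

/-- With `A*` finite, an ordinary Euclidean function in Motzkin's form (`a = bq + s`, `s = 0` or `φ s < φ b`) forces every
residue ring `A/Ab`, `b ≠ 0`, to be finite (the finite stages exhaust `A`, and `b ∈ A_{n+1}` has its classes represented
in the finite `A_n`). [cite: Samuel1971, §3 Remark (2) (p. 287)] -/
theorem finite_quotient_span_singleton_of_euclideanFunction
    (h : ∃ φ : R → ℕ, ∀ a b : R, b ≠ 0 → ∃ q s : R, a = b * q + s ∧ (s = 0 ∨ φ s < φ b)) {b : R} (hb : b ≠ 0) :
    Finite (R ⧸ Ideal.span {b}) := by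
  obtain ⟨φ, hφ⟩ := h
  haveI := isPrincipalIdealRing_of_euclideanFunction φ hφ
  have hu := exists_euclideanFunction_iff_iUnion_samuelSet_natCast.1 ⟨φ, hφ⟩
  obtain ⟨n, hn⟩ := Set.mem_iUnion.1 (Set.eq_univ_iff_forall.1 hu b)
  exact finite_quotient_span_singleton_of_mem_samuelSet_natCast hb hn

/-- Samuel's `ℤ × ℤ` argument in general, Motzkin's form: a ring with finitely many units and some `b ≠ 0` with `A/Ab`
infinite is not Euclidean for any ordinary Euclidean function.  The instance `ℤ × ℤ`, `b = (1, 0)` is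
`IntProd.not_exists_euclideanFunction`. [cite: Samuel1971, §3 Remark (2) (p. 287)] -/
theorem not_exists_euclideanFunction_of_infinite_quotient {b : R} (hb : b ≠ 0) [Infinite (R ⧸ Ideal.span {b})] :
    ¬ ∃ φ : R → ℕ, ∀ a b : R, b ≠ 0 → ∃ q s : R, a = b * q + s ∧ (s = 0 ∨ φ s < φ b) := by
  intro h
  haveI := finite_quotient_span_singleton_of_euclideanFunction h hb
  exact not_finite (R ⧸ Ideal.span {b})

/-- **Remark (F) with Proposition 15**: a ring with finitely many units which is exhausted by its transfinite construction
(Samuel's «Euclidean») carries an ordinary `ℕ`-valued Euclidean function iff all its residue rings `A/Ab`, `b ≠ 0`, are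
finite — (F) gives «only if», Prop. 15 (`exists_euclideanFunction_of_finite_quotients`) gives «if».
[cite: Samuel1971, §3 Remark (2) (p. 287) and Prop. 15 (p. 294)] -/
theorem exists_euclideanFunction_iff_finite_quotients (h : ∀ x : R, ∃ α : Ordinal.{u}, x ∈ samuelSet R α) :
    (∃ φ : R → ℕ, ∀ a b : R, b ≠ 0 → ∃ q s : R, a = b * q + s ∧ (s = 0 ∨ φ s < φ b)) ↔
      ∀ b : R, b ≠ 0 → Finite (R ⧸ Ideal.span {b}) :=
  ⟨fun hφ _ hb ↦ finite_quotient_span_singleton_of_euclideanFunction hφ hb,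
    fun hfin ↦ exists_euclideanFunction_of_finite_quotients hfin h⟩

end Synthesis

end Literature.Algebra.EuclideanDomain
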